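import Summits.QuantumFields.YangMills.Theorems.SqueezedSkewnessSpectralIdentificationLJointDiagonal
import HarnessLib

/-!
# Joint diagonalisation of a compact POSITIVE self-adjoint operator (no contraction hypothesis) with a commuting unitary representation
# of `(ℤ/(2L+1))³`, and the Källén–Lehmann Parseval identity — for STUB `stub_mixedParseval` of crux `SqueezedSkewness.TorusKL`
# (stmt-QuantumFields-23204; planner ym-idea-6 g10, LINE α «torus-direct Källén–Lehmann»)

Verbatim twin of `SqueezedSkewnessJointDiagonal.jointDiagonal_hasSum` (seat ym-line-fcl-p3 g14, stub `stub_jointDiagonal` of crux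
`SpectralIdentificationL`) with the contraction hypothesis `‖P‖ ≤ 1` REMOVED: on the finite-period torus the reduced transfer operator
`P = 𝕋/λ_i` on a reference state's complement is NOT a contraction (the image / 'around-the-world' atoms are its eigenvalues `> 1`), so the
conclusion keeps only `0 ≤ μ_n` (positivity of `P`).  Everything else — isotypic projections of `(ℤ/(2L+1))³`
(`SqueezedSkewnessIsotypicProjections`), eigenbases of the compact self-adjoint `P Π_q` (tree `exists_hilbertBasis_eigenvectors_of_isSelfAdjoint`),
the coefficient identity, Parseval per `q`, Pythagoras over `q`, countable support re-indexed by `ℕ` — is the landed proof BY NAME.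
Width seat `ym-line-sfw-p2-w2` g22 (cell ym-idea-1; free hands).  THEOREMS ONLY.  HONEST FRAMING: pure operator theory; no lattice measure,
no crux, no NT statement, no thermal limit and no mass gap is proved here.
References: M. Reed, B. Simon, *Methods of Modern Mathematical Physics I* (1980), Thm. VI.16 [cite: ReedSimonI1980, Thm. VI.16].
-/

set_option autoImplicit false

noncomputable section

open scoped InnerProductSpace ComplexConjugate BigOperators
open Complex Finset

namespace Summit.QuantumFields.YangMills.Theorems.SqueezedSkewnessJointDiagonal

variable {E : Type*} [NormedAddCommGroup E] [InnerProductSpace ℂ E] [CompleteSpace E]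

open Literature.MathematicalPhysics.QuantumLattice (siteToE)

/-- **Joint diagonalisation and the Källén–Lehmann Parseval identity for a compact positive self-adjoint operator** (generic Hilbert
space; NO contraction hypothesis): weights `W_n ≥ 0`, levels `μ_n ≥ 0` and momenta `q_n ∈ ℤ³`, independent of the test function, with
`Σ_n W_n |Σ_x f(sx) μ_n^{x₀−1} e^{2πi q_n·x⃗/(2L+1)}|² = ‖Σ_x f(sx) P^{x₀−1} U(x⃗) ψ₀‖²`. [cite: ReedSimonI1980, Thm. VI.16] -/
theorem jointDiagonal_hasSum_pos (L : ℕ) (s : ℝ) (hs : 0 < s) (P : E →L[ℂ] E) (U : (Fin 3 → ℤ) → (E →L[ℂ] E)) (ψ₀ : E)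
    (hPsa : IsSelfAdjoint P) (hPc : IsCompactOperator P) (hPpos : ∀ v : E, 0 ≤ RCLike.re (inner ℂ (P v) v))
    (hU0 : U 0 = 1) (hUadd : ∀ x y : Fin 3 → ℤ, U (x + y) = U x * U y)
    (hUper : ∀ x y : Fin 3 → ℤ, (∀ i, ((x i : ℤ) : ZMod (2 * L + 1)) = ((y i : ℤ) : ZMod (2 * L + 1))) → U x = U y)
    (hUnorm : ∀ (x : Fin 3 → ℤ) (v : E), ‖U x v‖ = ‖v‖) (hPU : ∀ x : Fin 3 → ℤ, P * U x = U x * P) :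
    ∃ (W μ : ℕ → ℝ) (q : ℕ → Fin 3 → ℤ), (∀ n, 0 ≤ W n) ∧ (∀ n, 0 ≤ μ n) ∧
      ∀ (H : ℝ) (f : SchwartzMap (EuclideanSpace ℝ (Fin 4)) ℝ),
        tsupport (f : EuclideanSpace ℝ (Fin 4) → ℝ) ⊆ {y : EuclideanSpace ℝ (Fin 4) | 0 < y 0 ∧ y 0 ≤ H} →
        tsupport (f : EuclideanSpace ℝ (Fin 4) → ℝ) ⊆ {y : EuclideanSpace ℝ (Fin 4) | ∀ i : Fin 3, |y i.succ| < s * (L + 1 / 2)} →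
        HasSum (fun n : ℕ => W n * ‖(∑' x : Fin 4 → ℤ, (((f (s • siteToE (d := 4) x) * μ n ^ (Int.toNat (x 0 - 1))) : ℝ) : ℂ) *
            Complex.exp (Complex.I * ((s * ∑ k : Fin 3, (2 * Real.pi * (q n k : ℝ) / (s * (2 * L + 1))) * (x k.succ : ℝ) : ℝ) : ℂ)))‖ ^ 2)
          (‖(∑' x : Fin 4 → ℤ, ((f (s • siteToE (d := 4) x) : ℝ) : ℂ) •
            ((P ^ (Int.toNat (x 0 - 1))) ((U (fun i : Fin 3 => x i.succ)) ψ₀)))‖ ^ 2) := by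
  classical
  haveI hN0 : NeZero (2 * L + 1) := ⟨by omega⟩
  -- §1 the finite representation `V` of `Γ = (ℤ/(2L+1))³`
  let V : (Fin 3 → ZMod (2 * L + 1)) → E →L[ℂ] E := fun γ => U (fun i => ((γ i).val : ℤ))
  have hUV : ∀ y : Fin 3 → ℤ, U y = V (fun i => (y i : ZMod (2 * L + 1))) := fun y =>
    hUper _ _ (fun i => by simp)
  have hV0 : V 0 = 1 := by
    have : (fun i : Fin 3 => (((0 : Fin 3 → ZMod (2 * L + 1)) i).val : ℤ)) = 0 := by
      funext i; simp [ZMod.val_zero]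
    show U _ = 1
    rw [this, hU0]
  have hVadd : ∀ γ γ', V (γ + γ') = V γ * V γ' := fun γ γ' => by
    show U _ = U _ * U _
    rw [← hUadd]
    refine hUper _ _ (fun i => ?_)
    push_cast
    simp
  have hVnorm : ∀ γ v, ‖V γ v‖ = ‖v‖ := fun γ v => hUnorm _ v
  have hPV : ∀ γ, P * V γ = V γ * P := fun γ => hPU _
  -- §2 the characters and the isotypic projections
  let χ : (Fin 3 → ZMod (2 * L + 1)) → (Fin 3 → ZMod (2 * L + 1)) → ℂ := fun q γ => ∏ k, ZMod.stdAddChar (q k * γ k)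
  have hχadd : ∀ q γ γ', χ q (γ + γ') = χ q γ * χ q γ' := fun q γ γ' => bichar_add q γ γ'
  have hχconj : ∀ q γ, conj (χ q γ) = χ q (-γ) := fun q γ => bichar_conj q γ
  have hχorth : ∀ q q', ∑ γ, χ q γ * conj (χ q' γ) = if q = q' then (Fintype.card (Fin 3 → ZMod (2 * L + 1)) : ℂ) else 0 :=
    fun q q' => bichar_orth q q'
  have hχdual : ∀ γ, ∑ q, conj (χ q γ) = if γ = 0 then (Fintype.card (Fin 3 → ZMod (2 * L + 1)) : ℂ) else 0 :=
    fun γ => bichar_dual γ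
  let Pr : (Fin 3 → ZMod (2 * L + 1)) → E →L[ℂ] E := fun q =>
    ((Fintype.card (Fin 3 → ZMod (2 * L + 1)) : ℂ)⁻¹) • ∑ γ, conj (χ q γ) • V γ
  have hPr : ∀ q, Pr q = ((Fintype.card (Fin 3 → ZMod (2 * L + 1)) : ℂ)⁻¹) • ∑ γ, conj (χ q γ) • V γ := fun q => rfl
  have hidem : ∀ q, Pr q * Pr q = Pr q := fun q => by
    have h := proj_mul_proj χ V Pr hχadd hχconj hχorth hVadd hPr q q
    rwa [if_pos rfl] at h
  have hcommP : ∀ q, P * Pr q = Pr q * P := comm_proj χ V Pr P hPV hPr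
  have hsaPr : ∀ q, IsSelfAdjoint (Pr q) := isSelfAdjoint_proj χ V Pr hχconj hV0 hVadd hVnorm hPr
  have hPrV : ∀ q γ, Pr q * V γ = χ q γ • Pr q := proj_mul_rep χ V Pr hχadd hχconj hVadd hPr
  have hinnerPr : ∀ q (u v : E), ⟪Pr q u, v⟫_ℂ = ⟪u, Pr q v⟫_ℂ := inner_proj_left χ V Pr hχconj hV0 hVadd hVnorm hPr
  -- §3 `T_q = P Π_q` and its eigenbases
  have hTsa : ∀ q, IsSelfAdjoint (P * Pr q) := fun q => (IsSelfAdjoint.commute_iff hPsa (hsaPr q)).1 (hcommP q)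
  have hTc : ∀ q, IsCompactOperator (P * Pr q) := fun q => hPc.comp_clm (Pr q)
  choose sI b κ hb hTb using fun q =>
    Literature.Analysis.OperatorTheory.exists_hilbertBasis_eigenvectors_of_isSelfAdjoint (hTc q) (hTsa q)
  -- §4 the f-independent data on the index set `I = Σ q, sI q`
  let Wf : (Σ q, sI q) → ℝ := fun ι => ‖⟪b ι.1 ι.2, Pr ι.1 ψ₀⟫_ℂ‖ ^ 2
  let μf : (Σ q, sI q) → ℝ := fun ι => κ ι.1 ι.2
  let qf : (Σ q, sI q) → (Fin 3 → ℤ) := fun ι k => ((ι.1 k).val : ℤ)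
  have hWf0 : ∀ ι, 0 ≤ Wf ι := fun ι => by positivity
  have hμf : ∀ ι, 0 ≤ μf ι := by
    rintro ⟨q, i⟩
    have hnb : ‖b q i‖ = 1 := (b q).orthonormal.1 i
    have heig := hTb q i
    -- κ = ⟪b, T b⟫
    have hκ : ((κ q i : ℝ) : ℂ) = ⟪b q i, (P * Pr q) (b q i)⟫_ℂ := by
      rw [heig, inner_smul_right, inner_self_eq_norm_sq_to_K, hnb]; simp
    have hw : ⟪b q i, (P * Pr q) (b q i)⟫_ℂ = ⟪Pr q (b q i), P (Pr q (b q i))⟫_ℂ := by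
      conv_lhs => rw [← hidem q]
      rw [mul_apply_eq_comp, mul_apply_eq_comp, ← mul_apply_eq_comp P (Pr q), hcommP q, mul_apply_eq_comp, hinnerPr]
    have h1 : 0 ≤ RCLike.re ⟪P (Pr q (b q i)), Pr q (b q i)⟫_ℂ := hPpos _
    rw [← inner_conj_symm, RCLike.conj_re] at h1
    have : (κ q i : ℝ) = RCLike.re ⟪Pr q (b q i), P (Pr q (b q i))⟫_ℂ := by
      rw [← hw, ← hκ]; simp
    show 0 ≤ κ q i
    rw [this]; exact h1
  -- §5 countable support of the weights, re-indexing by `ℕ`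
  have hWsum : ∀ q, HasSum (fun i : sI q => ‖⟪b q i, Pr q ψ₀⟫_ℂ‖ ^ 2) (‖Pr q ψ₀‖ ^ 2) := fun q =>
    hasSum_norm_sq_inner (b q) _
  have hWfsum : Summable Wf := by
    refine (summable_sigma_of_nonneg hWf0).2 ⟨fun q => (hWsum q).summable, ?_⟩
    exact (hasSum_fintype _).summable
  have hJ : (Function.support Wf).Countable := hWfsum.countable_support
  obtain ⟨e, he⟩ := Set.countable_iff_exists_injective.1 hJ
  refine ⟨Function.extend e (fun j => Wf j.1) 0, Function.extend e (fun j => μf j.1) 0, Function.extend e (fun j => qf j.1) 0,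
    ?_, ?_, ?_⟩
  · intro n
    by_cases hn : ∃ j, e j = n
    · obtain ⟨j, rfl⟩ := hn
      rw [he.extend_apply]; exact hWf0 _
    · rw [Function.extend_apply' _ _ _ hn]; simp
  · intro n
    by_cases hn : ∃ j, e j = n
    · obtain ⟨j, rfl⟩ := hn
      rw [he.extend_apply]; exact hμf _
    · rw [Function.extend_apply' _ _ _ hn]; simp
  -- §6 the identity for an admissible test function
  intro H f hf1 hf2
  -- abbreviations
  set c : (Fin 4 → ℤ) → ℂ := fun x => ((f (s • siteToE (d := 4) x) : ℝ) : ℂ) with hc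
  set m : (Fin 4 → ℤ) → ℕ := fun x => Int.toNat (x 0 - 1) with hm
  set B : Finset (Fin 4 → ℤ) :=
    Fintype.piFinset fun i : Fin 4 => if i = 0 then Finset.Icc (1 : ℤ) ⌈H / s⌉ else Finset.Icc (-(L : ℤ)) L with hB
  have hc0 : ∀ x ∉ B, c x = 0 := fun x hx => by
    simp only [hc, coeff_eq_zero_of_not_mem_box L hs H f hf1 hf2 x hx, Complex.ofReal_zero]
  -- the amplitude of index `ι` as a finite sum against the bicharacter
  let A : (Σ q, sI q) → ℝ := fun ι =>
    ‖(∑' x : Fin 4 → ℤ, (((f (s • siteToE (d := 4) x) * μf ι ^ (Int.toNat (x 0 - 1))) : ℝ) : ℂ) *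
      Complex.exp (Complex.I * ((s * ∑ k : Fin 3, (2 * Real.pi * (qf ι k : ℝ) / (s * (2 * L + 1))) * (x k.succ : ℝ) : ℝ) : ℂ)))‖ ^ 2
  have hA : ∀ ι : Σ q, sI q, A ι = ‖∑ x ∈ B, c x * (((κ ι.1 ι.2 : ℝ) : ℂ) ^ m x * χ ι.1 (fun k => (x k.succ : ZMod (2 * L + 1))))‖ ^ 2 := by
    rintro ⟨q, i⟩
    simp only [A]
    congr 2
    rw [tsum_eq_sum (s := B)]
    · refine Finset.sum_congr rfl fun x _ => ?_
      rw [phase_eq_bichar L hs q x]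
      push_cast
      simp only [hc, hm, χ]
      ring
    · intro x hx
      have : f (s • siteToE (d := 4) x) = 0 := coeff_eq_zero_of_not_mem_box L hs H f hf1 hf2 x hx
      rw [this]; simp
  -- the vector `v_f` as a finite sum
  set v : E := ∑' x : Fin 4 → ℤ, c x • ((P ^ m x) ((U (fun i : Fin 3 => x i.succ)) ψ₀)) with hv
  have hvB : v = ∑ x ∈ B, c x • ((P ^ m x) ((U (fun i : Fin 3 => x i.succ)) ψ₀)) := by
    rw [hv, tsum_eq_sum (s := B)]
    intro x hx; rw [hc0 x hx, zero_smul]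
  -- the coefficient identity
  have hcoef : ∀ (q : Fin 3 → ZMod (2 * L + 1)) (i : sI q),
      ⟪b q i, Pr q v⟫_ℂ = (∑ x ∈ B, c x * (((κ q i : ℝ) : ℂ) ^ m x * χ q (fun k => (x k.succ : ZMod (2 * L + 1))))) *
        ⟪b q i, Pr q ψ₀⟫_ℂ := by
    intro q i
    rw [hvB, map_sum, inner_sum, Finset.sum_mul]
    refine Finset.sum_congr rfl fun x _ => ?_
    have hop : Pr q ((P ^ m x) ((U (fun i : Fin 3 => x i.succ)) ψ₀)) =
        χ q (fun k => (x k.succ : ZMod (2 * L + 1))) • ((P * Pr q) ^ m x) (Pr q ψ₀) := by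
      rw [hUV, ← mul_apply_eq_comp, ← mul_apply_eq_comp]
      have hcomm_pow : Pr q * P ^ m x = P ^ m x * Pr q := ((show Commute (Pr q) P from (hcommP q).symm).pow_right (m x)).eq
      rw [hcomm_pow, mul_assoc, hPrV, mul_smul_comm, pow_mul_proj_eq P (Pr q) (hcommP q) (hidem q) (m x), smul_apply,
        mul_apply_eq_comp]
    rw [map_smul, hop, inner_smul_right, inner_smul_right,
      inner_eigen_pow (P * Pr q) (hTsa q) (b q i) (κ q i) (hTb q i) (m x) (Pr q ψ₀)]
    ring
  -- Parseval per `q`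
  have hPars : ∀ q, HasSum (fun i : sI q => Wf ⟨q, i⟩ * A ⟨q, i⟩) (‖Pr q v‖ ^ 2) := by
    intro q
    have h := hasSum_norm_sq_inner (b q) (Pr q v)
    have heq : (fun i : sI q => Wf ⟨q, i⟩ * A ⟨q, i⟩) = fun i => ‖⟪b q i, Pr q v⟫_ℂ‖ ^ 2 := by
      funext i
      rw [hcoef q i, hA ⟨q, i⟩, norm_mul, mul_pow]
      simp only [Wf]
      ring
    rw [heq]; exact h
  -- Pythagoras over `q`
  have hPyth : ‖v‖ ^ 2 = ∑ q, ‖Pr q v‖ ^ 2 := norm_sq_eq_sum_norm_sq_proj χ V Pr hχadd hχconj hχorth hχdual hV0 hVadd hVnorm hPr v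
  -- the sum over the Σ-type
  have key : HasSum (fun ι : Σ q, sI q => Wf ι * A ι) (‖v‖ ^ 2) := by
    rw [hPyth]
    refine HasSum.sigma_of_hasSum (hasSum_fintype _) hPars ?_
    refine (summable_sigma_of_nonneg fun ι => mul_nonneg (hWf0 ι) (by positivity)).2 ⟨fun q => (hPars q).summable, ?_⟩
    exact (hasSum_fintype _).summable
  -- restrict to the support of the weights and transfer to `ℕ`
  have hsupp : Function.support (fun ι : Σ q, sI q => Wf ι * A ι) ⊆ Function.support Wf := by
    intro ι hι
    simp only [Function.mem_support, ne_eq] at hι ⊢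
    intro h0; exact hι (by rw [h0, zero_mul])
  have h1 : HasSum ((fun ι : Σ q, sI q => Wf ι * A ι) ∘ ((↑) : Function.support Wf → Σ q, sI q)) (‖v‖ ^ 2) :=
    (hasSum_subtype_iff_of_support_subset hsupp).2 key
  have h2 := (hasSum_extend_zero he).2 h1
  convert h2 using 1
  funext n
  by_cases hn : ∃ j, e j = n
  · obtain ⟨j, rfl⟩ := hn
    rw [he.extend_apply, he.extend_apply, he.extend_apply, he.extend_apply]
    rfl
  · simp only [Function.extend_apply' _ _ _ hn, Pi.zero_apply, zero_mul]

end Summit.QuantumFields.YangMills.Theorems.SqueezedSkewnessJointDiagonal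

end
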